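import Summits.ResolutionOfSingularities.ResolutionOfSingularities.Theorems.PAlterationPialtSqueeze
import HarnessLib

/-!
# `PalterationThesis` (crux stmt-ResolutionOfSingularities-0552), line `Sketch` rev. c3:
# glue stub `stub_rrLU1_of_picoverOver` — over a perfect field, PICover alone implies RRLU1

Glue stub `stub_rrLU1_of_picoverOver` of the skeleton `Sketch` (rev. c3) for crux
stmt-ResolutionOfSingularities-0552 (`--supports`, it does not close the item): "over a perfect
field, PICover alone implies RRLU1: the Picover-side residue becomes local".

**Statement.** `K` perfect of characteristic `p`; PICover over `K` (`hPC`): every integral scheme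
mapping finitely, universally injectively and surjectively onto an integral REGULAR separated
`K`-scheme of finite type has a resolution. Then RRLU1 over `K`: for `K ⊆ F ⊆ L` with `F/K`
finitely generated and `L/F` purely inseparable, `B ⊆ L` a finitely generated regular
`K`-subalgebra with `Frac B = L`, and `O ⊇ B` a valuation ring of `L`, the valuation ring `O ∩ F`
of `F` is locally uniformizable over `K`.

**Proof.** `T := B ∩ F` (the Frobenius sandwich of item 0555): `T` is finitely generated over `K`
(`fg_comap_toAlgHom`), `Frac T = F` (`isFractionRing_comap_toAlgHom`), `T` is integrally closed
as `B` is regular hence normal (`isIntegrallyClosed_of_isRegularRing`,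
`isIntegrallyClosed_comap_toAlgHom`), and `Spec B → Spec T` is finite, universally injective and
surjective (`rr_spec_comap_toAlgHom`). As `K` is perfect and `Spec T` normal, Frobenius
domination (`exists_frobeniusCover_of_finite_universallyInjective`) gives a scheme `N ≅ Spec T`
that is a finite, universally injective, surjective cover of the regular `Spec B`; `hPC` resolves
`N`, hence `Spec T`; and `T ⊆ O ∩ F`, so a resolution of this affine model uniformizes `O ∩ F`
(`exists_affineModel_regular_of_hasResolution`). The height-one hypothesis (`L = F(y)`,
`y ^ p ∈ F`) and the finite generation of `F/K` are not needed.

Source: M. Temkin, *Inseparable local uniformization*, J. Algebra 373 (2013), Rem. 1.3.5 (i)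
(Frobenius domination); J. Kollár, Ann. of Math. 145 (1997), Prop. 6.6.
-/

set_option linter.dupNamespace false -- mandated namespace of this single-conjunct summit

noncomputable section

open CategoryTheory CategoryTheory.Limits AlgebraicGeometry TopologicalSpace IsLocalRing
open Literature.AlgebraicGeometry.Resolution
open Summit.ResolutionOfSingularities.ResolutionOfSingularities.Theorems.Pialt.RadiciallyRegular
open Summit.ResolutionOfSingularities.ResolutionOfSingularities.Theorems

namespace Summit.ResolutionOfSingularities.ResolutionOfSingularities.Theorems.PalterationThesis.PerfectAtoms

/-- **Over a perfect field, PICover alone implies RRLU1** (glue stub `stub_rrLU1_of_picoverOver`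
of line `Sketch` rev. c3, crux stmt-0552). Let `K` be a PERFECT field of characteristic `p` over
which every integral scheme that is a finite, universally injective, surjective cover of an
integral regular separated `K`-scheme of finite type has a resolution (`hPC`). Then for fields
`K ⊆ F ⊆ L` with `L/F` purely inseparable, a finitely generated REGULAR `K`-subalgebra `B ⊆ L`
with `Frac B = L` and a valuation ring `O ⊇ B` of `L`, the valuation ring `O ∩ F` of `F` is
locally uniformizable over `K`: with `T := B ∩ F` (finitely generated, `Frac T = F`, normal,
`Spec B → Spec T` finite radicial surjective — the Frobenius sandwich), Frobenius domination
(`exists_frobeniusCover_of_finite_universallyInjective`) makes a scheme `N ≅ Spec T` a finite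
radicial surjective cover of the regular `Spec B`; `hPC` resolves `N`, hence `Spec T`, and since
`T ⊆ O ∩ F` a resolution of this affine model uniformizes `O ∩ F`
(`exists_affineModel_regular_of_hasResolution`). [cite: Temkin2013, Rem. 1.3.5 (i)] -/
theorem stub_rrLU1_of_picoverOver (p : ℕ) (hp : p.Prime) (K : Type) [Field K] [CharP K p]
    [PerfectField K]
    (hPC : ∀ (Y X : Scheme.{0}) (f : Y ⟶ Spec (.of K)) (g : X ⟶ Y),
      IsSeparated f → LocallyOfFiniteType f → QuasiCompact f → IsIntegral Y →
      Scheme.IsRegular Y → IsIntegral X → IsFinite g → UniversallyInjective g →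
      Function.Surjective g.base → Scheme.HasResolution X) :
    ∀ (F L : Type) [Field F] [Field L] [Algebra K F] [Algebra F L] [Algebra K L]
      [IsScalarTower K F L], (⊤ : IntermediateField K F).FG → IsPurelyInseparable F L →
      (∃ y : L, y ^ p ∈ (algebraMap F L).range ∧ IntermediateField.adjoin F {y} = ⊤) →
      ∀ B : Subalgebra K L, B.FG → IsFractionRing B L → IsRegularRing B →
      ∀ O : ValuationSubring L, B.toSubring ≤ O.toSubring →
        IsLocallyUniformizable K F (O.comap (algebraMap F L)) := by
  intro F L _ _ _ _ _ _ _hFfg hpi _hy B hBfg hBfr hBreg O hBO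
  haveI : Fact p.Prime := ⟨hp⟩
  -- `B` is regular, hence `Spec B` is regular and `B` is normal
  have hBreg' : Scheme.IsRegular (Spec (.of B)) := Scheme.isRegular_Spec (.of B)
  have hBn : IsIntegrallyClosed B := isIntegrallyClosed_of_isRegularRing B
  -- the Frobenius sandwich `T := B ∩ F ⊆ O ∩ F`
  set T : Subalgebra K F := B.comap (IsScalarTower.toAlgHom K F L) with hTdef
  have hTfg : T.FG := fg_comap_toAlgHom p B hBfg
  have hTfr : IsFractionRing T F := isFractionRing_comap_toAlgHom p B
  have hTn : IsIntegrallyClosed T := isIntegrallyClosed_comap_toAlgHom p B hBn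
  obtain ⟨W, h, hW, hreg, hfin, hui, hsurj⟩ := rr_spec_comap_toAlgHom (K := F) p B hBfg hBreg'
  have hTO : T.toSubring ≤ (O.comap (algebraMap F L)).toSubring := by
    intro x hx
    exact hBO (show IsScalarTower.toAlgHom K F L x ∈ B from hx)
  haveI := hTfr
  haveI := hW
  haveI := hfin
  haveI := hui
  haveI := hTn
  haveI : Algebra.FiniteType K T := T.fg_iff_finiteType.mp hTfg
  -- `Spec T` as an integral, normal `K`-scheme of finite type
  haveI : IsDomain (CommRingCat.of T) := inferInstanceAs (IsDomain T)
  haveI : IsIntegrallyClosed (CommRingCat.of T) := hTn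
  let fT : Spec (.of T) ⟶ Spec (.of K) := Spec.map (CommRingCat.ofHom (algebraMap K T))
  haveI : LocallyOfFiniteType fT :=
    (HasRingHomProperty.Spec_iff (P := @LocallyOfFiniteType)).mpr
      (RingHom.finiteType_algebraMap.mpr ‹_›)
  have hTn' : ∀ y : Spec (.of T), IsIntegrallyClosed ((Spec (.of T)).presheaf.stalk y) :=
    Literature.AlgebraicGeometry.Motives.isIntegrallyClosed_stalk_Spec (.of T)
  haveI : IsDominant h := ⟨hsurj.denseRange⟩
  -- Frobenius domination: `N ≅ Spec T` covers the regular `W` finitely, radicially, surjectively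
  obtain ⟨N, ψ, φ, hNint, hφ, hψfin, hψui, hψsurj⟩ :=
    exists_frobeniusCover_of_finite_universallyInjective hp K W (Spec (.of T)) fT h hTn'
  haveI := hNint
  haveI := hφ
  haveI := hψfin
  haveI := hψui
  -- PICover over `K` resolves `N`, hence `Spec T`
  haveI : IsSeparated (h ≫ fT) := inferInstance
  haveI : LocallyOfFiniteType (h ≫ fT) := inferInstance
  haveI : QuasiCompact (h ≫ fT) := inferInstance
  have hres : Scheme.HasResolution N :=
    hPC W N (h ≫ fT) ψ inferInstance inferInstance inferInstance hW hreg hNint hψfin hψui hψsurj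
  have hresT : Scheme.HasResolution (Spec (.of T)) := Scheme.HasResolution.of_iso φ hres
  -- a resolution of the affine model `T ⊆ O ∩ F` uniformizes `O ∩ F`
  obtain ⟨A', h', hle, hA'fg, hreg'⟩ :=
    exists_affineModel_regular_of_hasResolution (O.comap (algebraMap F L)) T hTO hTfg hTfr hresT
  exact ⟨A', h', hA'fg, isFractionRing_of_le hle hTfr, hreg'⟩

end Summit.ResolutionOfSingularities.ResolutionOfSingularities.Theorems.PalterationThesis.PerfectAtoms

end
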